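import Summits.MatrixMultiplication.OmegaCensus.DihedralLawModOneZ11Z11Orders
import HarnessLib

/-!
# Instances of the `ℤ_11²`-quotient law exclusions: `ℤ₁₁ × ℤ₄₄`, `ℤ₂₂ × ℤ₂₂`, `ℤ₁₁ × ℤ₇₇`

ω-census `pub-omega`, family (b3), seat pub-omega-group gen 38.  Framing: lottery ticket; floor = certified bounds/negative ranges.
VALUE: named kernel instances of `no_mod_one_law_card_N_of_onto_z11z11` (`DihedralLawModOneZ11Z11Orders.lean`) for the census lines `|A| = 484, 847`:
no dihedral-like group over these abelian groups (any `c₀`) has a TPP triple with `3|S||T||U| + 8 = 8|A|`; NOT progress on ω.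
-/

namespace Summit.MatrixMultiplication.OmegaCensus

open Literature.Combinatorics.Additive Finset

section Instances

variable {G : Type} [Group G] [DecidableEq G] {S T U : Finset G}

/-- Every element of `ℤ₁₁ × ℤ₄₄ (≅ ℤ₄ × ℤ₁₁²)` has order `≤ 44 < |A|/2`. [folklore] -/
theorem two_mul_addOrderOf_lt_z11_z44 (g : ZMod 11 × ZMod 44) : 2 * addOrderOf g < Fintype.card (ZMod 11 × ZMod 44) := by
  have h1 : addOrderOf g.1 ∣ 44 := (addOrderOf_dvd_card (x := g.1)).trans (by rw [ZMod.card]; norm_num)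
  have h2 : addOrderOf g.2 ∣ 44 := (addOrderOf_dvd_card (x := g.2)).trans (by rw [ZMod.card])
  have hle : addOrderOf g ≤ 44 := Nat.le_of_dvd (by norm_num) (by rw [Prod.addOrderOf]; exact Nat.lcm_dvd h1 h2)
  have hA : Fintype.card (ZMod 11 × ZMod 44) = 484 := by simp [Fintype.card_prod, ZMod.card]
  omega

/-- **`ℤ₁₁ × ℤ₄₄ (≅ ℤ₄ × ℤ₁₁²)` (`|A| = 484`): no dihedral-like group over it (any `c₀`) has a TPP triple attaining `3|S||T||U| + 8 = 8|A|`.** [folklore] -/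
theorem no_mod_one_law_z11_z44 {ρ τ : ZMod 11 × ZMod 44 → G} {c₀ : ZMod 11 × ZMod 44}
    (hρρ : ∀ a b, ρ a * ρ b = ρ (a + b)) (hρτ : ∀ a b, ρ a * τ b = τ (b - a))
    (hτρ : ∀ a b, τ a * ρ b = τ (a + b)) (hττ : ∀ a b, τ a * τ b = ρ (c₀ + b - a))
    (hρ : Function.Injective ρ) (hτ : Function.Injective τ) (hne : ∀ a b, ρ a ≠ τ b)
    (hsurj : ∀ g, (∃ a, ρ a = g) ∨ (∃ a, τ a = g)) (h : TripleProductProperty S T U) :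
    3 * (S.card * T.card * U.card) + 8 ≠ 8 * Fintype.card (ZMod 11 × ZMod 44) := by
  refine no_mod_one_law_card_484_of_onto_z11z11 (by simp [Fintype.card_prod, ZMod.card]) two_mul_addOrderOf_lt_z11_z44
    hρρ hρτ hτρ hττ hρ hτ hne hsurj
    ((AddMonoidHom.id (ZMod 11)).prodMap (ZMod.castHom (show 11 ∣ 44 by norm_num) (ZMod 11)).toAddMonoidHom) ?_ h
  intro q
  obtain ⟨b, hb⟩ := ZMod.castHom_surjective (show 11 ∣ 44 by norm_num) (n := 44) q.2
  exact ⟨(q.1, b), Prod.ext rfl hb⟩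

/-- Every element of `ℤ₂₂ × ℤ₂₂ (≅ ℤ₂² × ℤ₁₁²)` has order `≤ 22 < |A|/2`. [folklore] -/
theorem two_mul_addOrderOf_lt_z22_z22 (g : ZMod 22 × ZMod 22) : 2 * addOrderOf g < Fintype.card (ZMod 22 × ZMod 22) := by
  have h1 : addOrderOf g.1 ∣ 22 := (addOrderOf_dvd_card (x := g.1)).trans (by rw [ZMod.card])
  have h2 : addOrderOf g.2 ∣ 22 := (addOrderOf_dvd_card (x := g.2)).trans (by rw [ZMod.card])
  have hle : addOrderOf g ≤ 22 := Nat.le_of_dvd (by norm_num) (by rw [Prod.addOrderOf]; exact Nat.lcm_dvd h1 h2)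
  have hA : Fintype.card (ZMod 22 × ZMod 22) = 484 := by simp [Fintype.card_prod, ZMod.card]
  omega

/-- **`ℤ₂₂ × ℤ₂₂ (≅ ℤ₂² × ℤ₁₁²)` (`|A| = 484`): no dihedral-like group over it (any `c₀`) has a TPP triple attaining `3|S||T||U| + 8 = 8|A|`.** [folklore] -/
theorem no_mod_one_law_z22_z22 {ρ τ : ZMod 22 × ZMod 22 → G} {c₀ : ZMod 22 × ZMod 22}
    (hρρ : ∀ a b, ρ a * ρ b = ρ (a + b)) (hρτ : ∀ a b, ρ a * τ b = τ (b - a))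
    (hτρ : ∀ a b, τ a * ρ b = τ (a + b)) (hττ : ∀ a b, τ a * τ b = ρ (c₀ + b - a))
    (hρ : Function.Injective ρ) (hτ : Function.Injective τ) (hne : ∀ a b, ρ a ≠ τ b)
    (hsurj : ∀ g, (∃ a, ρ a = g) ∨ (∃ a, τ a = g)) (h : TripleProductProperty S T U) :
    3 * (S.card * T.card * U.card) + 8 ≠ 8 * Fintype.card (ZMod 22 × ZMod 22) := by
  refine no_mod_one_law_card_484_of_onto_z11z11 (by simp [Fintype.card_prod, ZMod.card]) two_mul_addOrderOf_lt_z22_z22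
    hρρ hρτ hτρ hττ hρ hτ hne hsurj
    ((ZMod.castHom (show 11 ∣ 22 by norm_num) (ZMod 11)).toAddMonoidHom.prodMap (ZMod.castHom (show 11 ∣ 22 by norm_num) (ZMod 11)).toAddMonoidHom) ?_ h
  intro q
  obtain ⟨a, ha⟩ := ZMod.castHom_surjective (show 11 ∣ 22 by norm_num) (n := 22) q.1
  obtain ⟨b, hb⟩ := ZMod.castHom_surjective (show 11 ∣ 22 by norm_num) (n := 22) q.2
  exact ⟨(a, b), Prod.ext ha hb⟩

/-- Every element of `ℤ₁₁ × ℤ₇₇ (the non-cyclic abelian group of order 847)` has order `≤ 77 < |A|/2`. [folklore] -/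
theorem two_mul_addOrderOf_lt_z11_z77 (g : ZMod 11 × ZMod 77) : 2 * addOrderOf g < Fintype.card (ZMod 11 × ZMod 77) := by
  have h1 : addOrderOf g.1 ∣ 77 := (addOrderOf_dvd_card (x := g.1)).trans (by rw [ZMod.card]; norm_num)
  have h2 : addOrderOf g.2 ∣ 77 := (addOrderOf_dvd_card (x := g.2)).trans (by rw [ZMod.card])
  have hle : addOrderOf g ≤ 77 := Nat.le_of_dvd (by norm_num) (by rw [Prod.addOrderOf]; exact Nat.lcm_dvd h1 h2)
  have hA : Fintype.card (ZMod 11 × ZMod 77) = 847 := by simp [Fintype.card_prod, ZMod.card]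
  omega

/-- **`ℤ₁₁ × ℤ₇₇ (the non-cyclic abelian group of order 847)` (`|A| = 847`): no dihedral-like group over it (any `c₀`) has a TPP triple attaining `3|S||T||U| + 8 = 8|A|`.** [folklore] -/
theorem no_mod_one_law_z11_z77 {ρ τ : ZMod 11 × ZMod 77 → G} {c₀ : ZMod 11 × ZMod 77}
    (hρρ : ∀ a b, ρ a * ρ b = ρ (a + b)) (hρτ : ∀ a b, ρ a * τ b = τ (b - a))
    (hτρ : ∀ a b, τ a * ρ b = τ (a + b)) (hττ : ∀ a b, τ a * τ b = ρ (c₀ + b - a))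
    (hρ : Function.Injective ρ) (hτ : Function.Injective τ) (hne : ∀ a b, ρ a ≠ τ b)
    (hsurj : ∀ g, (∃ a, ρ a = g) ∨ (∃ a, τ a = g)) (h : TripleProductProperty S T U) :
    3 * (S.card * T.card * U.card) + 8 ≠ 8 * Fintype.card (ZMod 11 × ZMod 77) := by
  refine no_mod_one_law_card_847_of_onto_z11z11 (by simp [Fintype.card_prod, ZMod.card]) two_mul_addOrderOf_lt_z11_z77
    hρρ hρτ hτρ hττ hρ hτ hne hsurj
    ((AddMonoidHom.id (ZMod 11)).prodMap (ZMod.castHom (show 11 ∣ 77 by norm_num) (ZMod 11)).toAddMonoidHom) ?_ h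
  intro q
  obtain ⟨b, hb⟩ := ZMod.castHom_surjective (show 11 ∣ 77 by norm_num) (n := 77) q.2
  exact ⟨(q.1, b), Prod.ext rfl hb⟩

end Instances

end Summit.MatrixMultiplication.OmegaCensus
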